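import Literature.NumberTheory.GaloisRepresentations.ContinuousH1
import HarnessLib

/-!
# `H¹` of a trivial module is the group of continuous homomorphisms, and inflation along a
# surjection is injective in degree one (theorems only)

Topic `NumberTheory/GaloisRepresentations`; namespace `Literature.NumberTheory.GaloisRepresentations`.
THEOREMS ONLY (no definition, no named fact; D-0026). Two elementary facts about Mathlib's
continuous cohomology in degree one, on the explicit cocycles of `ContinuousH1`
(Serre, *Galois Cohomology*, I §2.2–2.4; Neukirch–Schmidt–Wingberg, (1.6.6)–(1.6.7)):

* `contOneCocycles.apply_mul_of_trivial`, `oneCocycleClass_injective_of_trivial`,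
  `natCard_continuousCohomology_one_eq_of_trivial` — if `G` acts trivially on `X`, continuous
  crossed homomorphisms are continuous homomorphisms, every coboundary vanishes, and
  `[·] : Z¹_cont(G, X) → H¹_cont(G, X)` is a bijection ("`H¹(G, A) = Hom(G, A)` for trivial `A`",
  Serre I §2.3);
* `map_one_injective_of_surjective` — for a continuous SURJECTIVE homomorphism `θ : H → G` and a
  topological `G`-module `X`, the induced map `H¹_cont(G, X) → H¹_cont(H, res θ X)` is injective (the
  injectivity of inflation in the inflation–restriction sequence, NSW (1.6.7), in the generality of
  a surjection `θ` whose kernel need not act trivially on anything but through `θ`).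

Consumers (cell `b2b-bsdres`, Greenberg–Vatsal §2 Prop. (2.4) in the kernel): `H¹(I_v, D)` for the
trivial inertia modules `D` of the Tate filtration at a multiplicative place, and the passage from
the number-field inertia group `inertia v ≤ Γ_K` (image of `absInertia K_v`) to `absInertia K_v`.

## References

* [SerreGaloisCohomology1997] J.-P. Serre, *Galois Cohomology* (1997), I §2.2–§2.4.
* [NeukirchSchmidtWingberg2008] J. Neukirch, A. Schmidt, K. Wingberg, *Cohomology of Number
  Fields*, 2nd ed. (2008), (1.6.6)–(1.6.7).
-/

noncomputable section

open CategoryTheory Function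

namespace Literature.NumberTheory.GaloisRepresentations

open _root_.TopRep _root_.ContinuousCohomology _root_.Topology

universe u v

section Trivial

variable {R : Type u} [Ring R] [TopologicalSpace R]
variable {G : Type v} [Group G] [TopologicalSpace G] [IsTopologicalGroup G]
variable (X : TopRep.{v} R G)

omit [IsTopologicalGroup G] in
variable {X} in
/-- For a TRIVIAL action a continuous crossed homomorphism is a homomorphism:
`φ (g h) = φ g + φ h`. [cite: SerreGaloisCohomology1997, I §2.3] -/
theorem contOneCocycles.apply_mul_of_trivial (htriv : ∀ (g : G) (x : X), X.ρ g x = x)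
    (φ : contOneCocycles X) (g h : G) : φ.1 (g * h) = φ.1 g + φ.1 h := by
  rw [φ.2 g h, htriv]

/-- For a TRIVIAL action every coboundary vanishes, so `[·] : Z¹_cont(G, X) → H¹_cont(G, X)` is
injective: two continuous homomorphisms with the same class are equal
("`H¹(G, A) = Hom(G, A)`"). [cite: SerreGaloisCohomology1997, I §2.3] -/
theorem oneCocycleClass_injective_of_trivial (htriv : ∀ (g : G) (x : X), X.ρ g x = x) :
    Injective (oneCocycleClass X) := by
  intro φ ψ h
  have h0 : oneCocycleClass X (φ - ψ) = 0 := by rw [oneCocycleClass_sub, h, sub_self]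
  rw [oneCocycleClass_eq_zero_iff] at h0
  obtain ⟨v, hv⟩ := h0
  apply Subtype.ext
  ext g
  have := hv g
  rw [htriv, sub_self] at this
  exact sub_eq_zero.1 this

/-- For a TRIVIAL action, `H¹_cont(G, X)` is in bijection with the continuous homomorphisms
`G → X` (`Z¹_cont(G, X)`); in particular the two have the same cardinality.
[cite: SerreGaloisCohomology1997, I §2.3] -/
theorem natCard_continuousCohomology_one_eq_of_trivial (htriv : ∀ (g : G) (x : X), X.ρ g x = x) :
    Nat.card (continuousCohomology 1 X) = Nat.card (contOneCocycles X) :=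
  (Nat.card_eq_of_bijective (oneCocycleClass X)
    ⟨oneCocycleClass_injective_of_trivial X htriv, oneCocycleClass_surjective X⟩).symm

end Trivial

section Inflation

variable {R : Type u} [Ring R] [TopologicalSpace R]
variable {G : Type v} [Group G] [TopologicalSpace G] [IsTopologicalGroup G]
variable {H : Type v} [Group H] [TopologicalSpace H] [IsTopologicalGroup H]
variable (X : TopRep.{v} R G)

/-- **Inflation along a surjection is injective in degree one.** For a continuous surjective
homomorphism `θ : H → G` and a topological `G`-module `X`, the induced map
`H¹_cont(G, X) → H¹_cont(H, res θ X)`, `[φ] ↦ [φ ∘ θ]`, is injective: if `φ ∘ θ = ∂v` on `H` then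
`φ = ∂v` on `G = θ(H)`. [cite: NeukirchSchmidtWingberg2008, (1.6.6)–(1.6.7)]
[cite: SerreGaloisCohomology1997, I §2.4] -/
theorem map_one_injective_of_surjective (θ : H →ₜ* G) (hθ : Surjective θ) :
    Injective (ContinuousCohomology.map θ (𝟙 (res (θ : H →* G) X)) 1) := by
  intro x y hxy
  obtain ⟨φ, rfl⟩ := oneCocycleClass_surjective X x
  obtain ⟨ψ, rfl⟩ := oneCocycleClass_surjective X y
  rw [← sub_eq_zero, ← oneCocycleClass_sub]
  have h0 : ContinuousCohomology.map θ (𝟙 (res (θ : H →* G) X)) 1 (oneCocycleClass X (φ - ψ)) = 0 := by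
    rw [oneCocycleClass_sub, map_sub, sub_eq_zero]
    exact hxy
  rw [map_oneCocycleClass, oneCocycleClass_eq_zero_iff] at h0
  obtain ⟨v, hv⟩ := h0
  rw [oneCocycleClass_eq_zero_iff]
  refine ⟨v, fun g => ?_⟩
  obtain ⟨h, rfl⟩ := hθ g
  have := hv h
  rw [contOneCocycles.pullback_apply] at this
  exact this

end Inflation

end Literature.NumberTheory.GaloisRepresentations

end
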